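import Summits.AnomalousDissipation.AnomalousDissipation.Theorems.CoherentFractionSpectralHullGlue

/-!
# Glue of the QuotientHullCut split of `CoherentFraction.TameEulerClimatesPlanar` (stmt-AnomalousDissipation-27427)

Sorry-free proof of the GLUE item `CoherentFraction.QuotientHullGlue` (stmt-AnomalousDissipation-28077, route
route-AnomalousDissipation-CoherentFraction rev6/rev7): `FiniteTypeClimatesPlanar → InvariantExtremeClimatesPlanar →
InvariantExtremeReduction → TameEulerClimatesPlanar`, plus the EXACTNESS of the corrected cut
`TameEulerClimatesPlanar ↔ FiniteTypeClimatesPlanar ∧ InvariantExtremeClimatesPlanar ∧ InvariantExtremeReduction`,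
the helper `FiniteTypeClimatesPlanar → FiniteModeRootsPlanar` (28073 ⇒ 27870, Dirac bookkeeping), and the g18 ERRATUM
`TravellingWaveTransfer → ExtremeClimateReduction → (ExtremeClimatesPlanarBeyondFiniteModes ↔ TameEulerClimatesPlanar)`
(the g17 residual 27871 is TEP-strength modulo TW 28076 and ER 27872).
Mechanism (pure logic): `InvariantExtremeReduction` reduces planarity to extreme points of the horizontally-invariant tame
stationary class C̄(m,R); an extreme point is a member of C(m,R) (take the horizontal drift h = 0), so either it has finite
Fourier type (handled by `FiniteTypeClimatesPlanar`) or not (handled by `InvariantExtremeClimatesPlanar`).  No facts are asserted.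
Source: decomp-ad cell, lens-4 g18 node «QuotientHullCut» (kernel
`run/shared/lean/pub/decomp-ad/decomp-ad-lens-4/g18/QuotientHullCut.lean`, by-name certificate `g18/pkg/ByName_g18.lean`, theorems
`quotientHull_split` / `exact_split_TEP18` / `finiteType_implies_finiteModeRoots` / `erratum_residual_equiv`); landed by the cell's prover seat.
-/

set_option linter.dupNamespace false

noncomputable section

open scoped BigOperators Topology ENNReal
open Filter MeasureTheory

namespace Summit.AnomalousDissipation.AnomalousDissipation.Theorems.QuotientHullGlue

open Summit.AnomalousDissipation.AnomalousDissipation.Theses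
open Summit.AnomalousDissipation.AnomalousDissipation.Theses.CoherentFraction

open Summit.AnomalousDissipation.AnomalousDissipation.Theorems.SpectralHullGlue (measurableSingletonClass_energySpace
  tameEulerClimatesPlanar_of_pieces)

/-- F⁺ `FiniteTypeClimatesPlanar` (28073) is necessary for TEP (27427): drop the finite-type hypothesis. [folklore] -/
theorem finiteTypeClimatesPlanar_of_tame (h : TameEulerClimatesPlanar) : FiniteTypeClimatesPlanar :=
  fun m R μ hμ htame hstat _ => h m R μ hμ htame hstat

/-- Q♭ `InvariantExtremeClimatesPlanar` (28074) is necessary for TEP: an extreme point of C̄(m,R) is a member of C(m,R)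
(take the horizontal drift h = 0). [folklore] -/
theorem invariantExtremeClimatesPlanar_of_tame (h : TameEulerClimatesPlanar) : InvariantExtremeClimatesPlanar := by
  intro m R μ hext _
  obtain ⟨hμ, htame, hall⟩ := hext.1
  have h0 := hall 0 (by simp)
  simp only [add_zero] at h0
  exact h m R μ hμ htame h0

/-- Q̄R `InvariantExtremeReduction` (28075) is necessary for TEP (its conclusion is TEP's). [folklore] -/
theorem invariantExtremeReduction_of_tame (h : TameEulerClimatesPlanar) : InvariantExtremeReduction :=
  fun m R _ μ hμ htame hstat => h m R μ hμ htame hstat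

/-- The glued recombination F⁺ → Q♭ → Q̄R → TEP: reduce to extreme points of C̄(m,R) by Q̄R, then excluded middle on the
Fourier type of the extreme climate (finite type: F⁺ applies to it as a member of C(m,R), h = 0; infinite type: Q♭). [folklore] -/
theorem tameEulerClimatesPlanar_of_quotientPieces (hF : FiniteTypeClimatesPlanar) (hQ : InvariantExtremeClimatesPlanar)
    (hR : InvariantExtremeReduction) : TameEulerClimatesPlanar := by
  intro m R μ₀ hμ₀ htame₀ hstat₀
  refine hR m R (fun μ hext => ?_) μ₀ hμ₀ htame₀ hstat₀
  obtain ⟨hμ, htame, hall⟩ := hext.1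
  have h0 := hall 0 (by simp)
  simp only [add_zero] at h0
  by_cases hft : (∃ N : ℕ, ∀ᵐ (v : ↥(Literature.Analysis.FunctionSpaces.Torus.energySpace (Fin 3))) ∂μ, ((v : MeasureTheory.Lp (EuclideanSpace ℝ (Fin 3)) 2 (MeasureTheory.volume : MeasureTheory.Measure (UnitAddTorus (Fin 3)))) : UnitAddTorus (Fin 3) → EuclideanSpace ℝ (Fin 3)) =ᵐ[MeasureTheory.volume] Literature.Analysis.FunctionSpaces.Torus.fourierTruncate N ((v : MeasureTheory.Lp (EuclideanSpace ℝ (Fin 3)) 2 (MeasureTheory.volume : MeasureTheory.Measure (UnitAddTorus (Fin 3)))) : UnitAddTorus (Fin 3) → EuclideanSpace ℝ (Fin 3)))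
  · exact hF m R μ hμ htame h0 hft
  · exact hQ m R μ hext hft

/-- EXACTNESS of the QuotientHullCut (no side hypothesis): TEP (27427) ⟺ F⁺ ∧ Q♭ ∧ Q̄R (28073 ∧ 28074 ∧ 28075). [folklore] -/
theorem tameEulerClimatesPlanar_iff_quotientPieces :
    TameEulerClimatesPlanar ↔ (FiniteTypeClimatesPlanar ∧ InvariantExtremeClimatesPlanar ∧ InvariantExtremeReduction) :=
  ⟨fun h => ⟨finiteTypeClimatesPlanar_of_tame h, invariantExtremeClimatesPlanar_of_tame h, invariantExtremeReduction_of_tame h⟩,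
   fun h => tameEulerClimatesPlanar_of_quotientPieces h.1 h.2.1 h.2.2⟩

/-- The GLUE item `CoherentFraction.QuotientHullGlue` (stmt-AnomalousDissipation-28077) holds. [folklore] -/
theorem quotientHullGlue_holds : QuotientHullGlue :=
  fun hF hQ hR => tameEulerClimatesPlanar_of_quotientPieces hF hQ hR

/-- Helper of record (lens-4 g18 `finiteType_implies_finiteModeRoots`): F⁺ (28073) implies the g17 rung
`FiniteModeRootsPlanar` (27870) — apply F⁺ to the Dirac mass at a finite-mode root. [folklore] -/
theorem finiteModeRootsPlanar_of_finiteTypeClimatesPlanar (hF : FiniteTypeClimatesPlanar) : FiniteModeRootsPlanar := by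
  haveI := measurableSingletonClass_energySpace
  intro m R v hfin hR hstat
  obtain ⟨N, hN⟩ := hfin
  have hae := hF m R (MeasureTheory.Measure.dirac v) inferInstance
    (by rw [MeasureTheory.ae_dirac_eq]; exact Filter.eventually_pure.mpr hR)
    (fun Φ => by rw [MeasureTheory.integral_dirac]; exact hstat Φ)
    ⟨N, by rw [MeasureTheory.ae_dirac_eq]; exact Filter.eventually_pure.mpr hN⟩
  rw [MeasureTheory.ae_dirac_eq] at hae
  exact Filter.eventually_pure.mp hae

/-- T♭ `ExtremeClimatesPlanarBeyondFiniteModes` (27871) is necessary for TEP (27427). [folklore] -/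
theorem extremeClimatesPlanarBeyondFiniteModes_of_tame (h : TameEulerClimatesPlanar) :
    ExtremeClimatesPlanarBeyondFiniteModes :=
  fun m R μ hext _ => h m R μ hext.1.1 hext.1.2.1 hext.1.2.2

/-- The g18 ERRATUM (record E21′ of the cell): given the travelling-wave transfer TW (28076) and the Krein–Milman item ER (27872),
the g17 residual T♭ (27871) is EQUIVALENT to its parent TEP (27427) — it was not a strictly weaker piece. [folklore] -/
theorem extremeClimatesPlanarBeyondFiniteModes_iff_tame (hTW : TravellingWaveTransfer) (hER : ExtremeClimateReduction) :
    ExtremeClimatesPlanarBeyondFiniteModes ↔ TameEulerClimatesPlanar :=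
  ⟨fun hT => tameEulerClimatesPlanar_of_pieces (hTW hT) hT hER, extremeClimatesPlanarBeyondFiniteModes_of_tame⟩

end Summit.AnomalousDissipation.AnomalousDissipation.Theorems.QuotientHullGlue

end
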